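import Literature.NumberTheory.IwasawaTheory.ClassicalMuInvariantOnePrimeProofs
import Literature.NumberTheory.IwasawaTheory.ZpExtensionTotallyRamifiedFrom
import Literature.NumberTheory.NumberFields.ClassNumberPExtensionOnePrime
import Literature.NumberTheory.NumberFields.HilbertClassFieldMaximal
import Literature.NumberTheory.NumberFields.UnramifiedAbelianBaseChange
import HarnessLib

/-!
# Fukuda's Theorem 1 (1) at finite level — brick (C): the class-field-theoretic counting lemmas
# (Washington §13.3: «`X/Y_n ≃ A_n`», finite level: `[G : G'·⟨inertia⟩] ∣ h`, and the `p`-Hilbert class field in any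
# algebraically closed overfield) and Washington's Lemma 13.3 for ALL `p`

Topic `NumberTheory/IwasawaTheory` (namespace = path). THEOREM-ONLY file (no definition, no named fact, no `sorry`), written by
the prover seat `bsd-potss-k8t-c4` g19 (cell `bsd-potss`; Fukuda road of stmt-BirchSwinnertonDyer-19982; closes nothing). Brick (C)
of the finite-level proof of `fukuda1994_thm1_classNumberPExp_const_of_succ_eq` (`ClassicalMuInvariant.lean` §5; bricks (N)
`FukudaNakayamaFinite`, (G) `FukudaGroupStep`, (R) `ZpExtensionLayerRamificationDichotomy` landed; plan memo
`run/shared/lean/pub/bsd-potss/k8t-c4/g19/SCOPE-fukuda1994-thm1-holds-k8t-c4-g19.md`):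
* §1 `exists_inertia_not_le_kerSubgroup'` — Washington Lemma 13.3 «some prime ramifies in `K_∞/K`» for EVERY prime `p` (the tree's
  `exists_inertia_not_le_kerSubgroup` assumed `p ≠ 2` only to have the layers unramified at the infinite places by odd degree; that is now
  `ZpExtension.isUnramifiedAtInfinitePlaces_layer`, all `p`).
* §2 `index_commutator_sup_inertia_dvd_classNumber` — for a finite Galois extension `E/M` of number fields unramified at the infinite places,
  the subgroup `N = G'·⟨I(𝔔) : 𝔔⟩` generated by the commutators and all inertia groups has `[G : N] ∣ h(M)`: its fixed field is the maximal
  abelian subextension unramified at all places (Washington's `X/Y ≃ Gal(max. unram. abelian)` at finite level; Cox Cor. 5.24).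
* §3 `exists_intermediateField_pHilbert` — the `p`-HILBERT CLASS FIELD REALISED IN ANY algebraically closed `Ω ⊇ M`: an intermediate field
  `P/M` of `Ω`, abelian, unramified at all places, of degree `p^{ord_p h(M)}` (the fixed field of the prime-to-`p` part of `Gal(H_M/M)`,
  transported along an `M`-embedding `\bar M → Ω`).

References: [Washington1997] §13.1 Lemma 13.3, Prop. 13.2; §13.3 Lemmas 13.14–13.15; [Cox2013] §5.C Cor. 5.24, §8.A Thm. 8.10;
[Fukuda1994] Thm. 1 (1), p. 264.
-/

noncomputable section

open scoped NumberField
open NumberField IsDedekindDomain Field IntermediateField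

/-! ## §1 Washington's Lemma 13.3 for every `p` -/

namespace Literature.NumberTheory.IwasawaTheory

open Literature.NumberTheory.EllipticCurves Literature.NumberTheory.GaloisRepresentations
  Literature.NumberTheory.NumberFields

variable {K : Type} [Field K] [NumberField K] {p : ℕ} [Fact p.Prime]

/-- **Washington, Lemma 13.3 (first half), every `p`: in a `ℤ_p`-extension of a number field at least one prime ramifies** — some prime
`𝔓` of `\bar ℤ_K` (above `p`) has `I_𝔓 ⊄ Gal(K̄/K_∞)`. As the tree's `exists_inertia_not_le_kerSubgroup` (there `p ≠ 2`), with the layers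
unramified at the infinite places for every `p` by `ZpExtension.isUnramifiedAtInfinitePlaces_layer` (complex conjugations lie in `ker κ`):
otherwise every layer `K_n/K` is abelian of degree `pⁿ` and unramified at all places, so `pⁿ ∣ h_K` for all `n`.
[cite: Washington1997, §13.1 Lemma 13.3 and Prop. 13.2] [cite: Cox2013, §5.C Cor. 5.24] -/
theorem exists_inertia_not_le_kerSubgroup' (κ : ZpExtension K p) :
    ∃ (v : HeightOneSpectrum (𝓞 K)) (𝔓 : Ideal (absIntegers (𝓞 K) K)),
      ((p : ℕ) : 𝓞 K) ∈ v.asIdeal ∧ 𝔓 ∈ v.primesAbove ∧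
        ¬ 𝔓.inertia (absoluteGaloisGroup K) ≤ κ.kerSubgroup := by
  by_contra hcon
  push Not at hcon
  have hp : p.Prime := Fact.out
  have hI : ∀ (w : HeightOneSpectrum (𝓞 K)) (𝔓 : Ideal (absIntegers (𝓞 K) K)),
      𝔓 ∈ w.primesAbove → 𝔓.inertia (absoluteGaloisGroup K) ≤ κ.kerSubgroup := by
    intro w 𝔓 h𝔓
    by_cases hpw : ((p : ℕ) : 𝓞 K) ∈ w.asIdeal
    · exact hcon w 𝔓 hpw h𝔓
    · exact ZpExtension.inertia_le_kerSubgroup_holds K p κ hpw h𝔓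
  have hdvd : ∀ n : ℕ, p ^ n ∣ Fintype.card (ClassGroup (𝓞 K)) := by
    intro n
    haveI : FiniteDimensional K (κ.layer n) := κ.finiteDimensional_layer_holds n
    haveI : IsGalois K (κ.layer n) := κ.isGalois_layer_holds n
    haveI : IsAbelianGalois K (κ.layer n) := κ.isAbelianGalois_layer n
    haveI : NumberField (κ.layer n) := NumberField.of_module_finite K (κ.layer n)
    haveI : IsUnramifiedAtInfinitePlaces K (κ.layer n) := κ.isUnramifiedAtInfinitePlaces_layer n
    have h := hilbertClassField.finrank_dvd_classNumber_of_abelian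
      K (κ.layer n) (fun w ↦ ZpExtension.isUnramifiedIn_layer_of_forall_inertia_le κ hI n w)
    rwa [κ.finrank_layer_holds n] at h
  have hpos : 0 < Fintype.card (ClassGroup (𝓞 K)) := Fintype.card_pos
  exact absurd (Nat.le_of_dvd hpos (hdvd _)) (not_le.mpr (Nat.lt_pow_self hp.one_lt))

end Literature.NumberTheory.IwasawaTheory

/-! ## §2 `[G : G'·⟨inertia⟩] ∣ h(M)` for a finite Galois extension unramified at infinity -/

namespace Literature.NumberTheory.NumberFields

open scoped Pointwise

/-- **The maximal unramified abelian subextension has degree dividing the class number.** Let `E/M` be a finite Galois extension of number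
fields, unramified at the infinite places, `G = Gal(E/M)`, and `N ≤ G` a normal subgroup containing the commutator subgroup and the inertia
group of every prime of `E`. Then `[G : N] ∣ h(M)`: the fixed field of `N` is abelian over `M` (as `G/N` is) and unramified at every finite
prime (`I(𝔔) ≤ N`, `isUnramifiedAt_under_iff_inertia_le'`) and at infinity, hence inside the Hilbert class field (Cox Cor. 5.24,
`finrank_dvd_classNumber_of_isAbelianGalois`). Washington's `X/\overline{G'}·⟨I⟩` at finite level. [cite: Washington1997, §13.3 Lemma 13.15
(the maximal unramified abelian `p`-extension as a fixed field)] [cite: Cox2013, §5.C Cor. 5.24] -/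
theorem index_dvd_classNumber_of_commutator_le_of_inertia_le (M E : Type) [Field M] [NumberField M] [Field E]
    [NumberField E] [Algebra M E] [IsGalois M E] [IsUnramifiedAtInfinitePlaces M E] (N : Subgroup (E ≃ₐ[M] E)) [N.Normal]
    (hcomm : ⁅(⊤ : Subgroup (E ≃ₐ[M] E)), ⊤⁆ ≤ N)
    (hIN : ∀ (Q : Ideal (𝓞 E)) [Q.IsMaximal], Q.inertia (E ≃ₐ[M] E) ≤ N) :
    N.index ∣ classNumber M := by
  classical
  set F : IntermediateField M E := IntermediateField.fixedField N with hF
  haveI : IsGalois M F := IsGalois.of_fixedField_normal_subgroup N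
  have hFdeg : Module.finrank M F = N.index := by
    have h1 := Module.finrank_mul_finrank M F E
    rw [hF, IntermediateField.finrank_fixedField_eq_card N] at h1
    have h2 : N.index * Nat.card N = Nat.card (E ≃ₐ[M] E) := N.index_mul_card
    rw [IsGalois.card_aut_eq_finrank] at h2
    rw [hF]
    exact Nat.eq_of_mul_eq_mul_right Nat.card_pos (h1.trans h2.symm)
  -- `Gal(F/M) ≅ G/N` is commutative
  haveI : IsAbelianGalois M F := by
    refine { is_comm := ⟨fun x y => ?_⟩ }
    obtain ⟨x', rfl⟩ := (IsGalois.normalAutEquivQuotient N).surjective x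
    obtain ⟨y', rfl⟩ := (IsGalois.normalAutEquivQuotient N).surjective y
    rw [← map_mul, ← map_mul]
    congr 1
    have hc : IsMulCommutative ((E ≃ₐ[M] E) ⧸ N) := by
      rw [Subgroup.Normal.quotient_commutative_iff_commutator_le, commutator_def]
      exact hcomm
    exact hc.is_comm.comm x' y'
  haveI : IsUnramifiedAtInfinitePlaces M F :=
    isUnramifiedAtInfinitePlaces_of_algHom (IsScalarTower.toAlgHom M F E)
  have hunrF : ∀ v : HeightOneSpectrum (𝓞 M), Algebra.IsUnramifiedIn (𝓞 F) v.asIdeal := by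
    intro v q hq hqv
    haveI := hq
    have hq0 : q ≠ ⊥ := by
      intro h0
      apply v.ne_bot
      rw [hqv.over, h0, Ideal.under_def, Ideal.comap_bot_of_injective _
        (FaithfulSMul.algebraMap_injective (𝓞 M) (𝓞 F))]
    haveI : q.IsMaximal := hq.isMaximal hq0
    obtain ⟨Q, hQmax, hQq⟩ := Ideal.exists_maximal_ideal_liesOver_of_isIntegral (S := 𝓞 E) q
    haveI := hQmax
    have hq' : q = Q.under (𝓞 F) := hQq.over
    subst hq'
    rw [isUnramifiedAt_under_iff_inertia_le' F Q, hF, IntermediateField.fixingSubgroup_fixedField]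
    exact hIN Q
  have hdvd := finrank_dvd_classNumber_of_isAbelianGalois (K := M) F hunrF
  rwa [hFdeg] at hdvd

end Literature.NumberTheory.NumberFields

/-! ## §3 The `p`-part of a finite abelian group and the `p`-Hilbert class field inside any algebraically closed field -/

namespace Literature.NumberTheory.NumberFields

open scoped IsMulCommutative

/-- **The prime-to-`p` part of a finite abelian group has index `p^{ord_p #A}`**: `A₀ = {g : p ∤ ord g}` is a subgroup, `A/A₀` is a
`p`-group and `p ∤ #A₀` (Cauchy). The Sylow decomposition `A = A_p × A_{p'}` read through indices. [folklore]
[cite: Washington1997, §13.3 (proof of Prop. 13.22: passage to the `p`-part of the class group)] -/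
theorem exists_subgroup_index_eq_pow_padicValNat_card (A : Type*) [CommGroup A] [Finite A] (p : ℕ) [hp : Fact p.Prime] :
    ∃ A₀ : Subgroup A, (∀ g, g ∈ A₀ ↔ ¬ p ∣ orderOf g) ∧ A₀.index = p ^ padicValNat p (Nat.card A) := by
  classical
  let A₀ : Subgroup A :=
    { carrier := {g | ¬ p ∣ orderOf g}
      one_mem' := by
        change ¬ p ∣ orderOf (1 : A)
        rw [orderOf_one, Nat.dvd_one]; exact hp.out.ne_one
      mul_mem' := fun {a b} ha hb => fun hdvd => by
        rcases (Nat.Prime.dvd_mul hp.out).mp (hdvd.trans (Commute.all a b).orderOf_mul_dvd_mul_orderOf) with h | h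
        · exact ha h
        · exact hb h
      inv_mem' := fun {a} ha => by
        change ¬ p ∣ orderOf a⁻¹
        rw [orderOf_inv]; exact ha }
  have hmem : ∀ g, g ∈ A₀ ↔ ¬ p ∣ orderOf g := fun g => Iff.rfl
  refine ⟨A₀, hmem, ?_⟩
  -- the quotient is a `p`-group
  have hquot : IsPGroup p (A ⧸ A₀) := by
    intro q
    obtain ⟨a, rfl⟩ := QuotientGroup.mk_surjective q
    obtain ⟨m, c, hc, hmc⟩ := Nat.exists_eq_pow_mul_and_not_dvd (orderOf_pos a).ne' p hp.out.ne_one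
    refine ⟨m, ?_⟩
    rw [← QuotientGroup.mk_pow, QuotientGroup.eq_one_iff, hmem, orderOf_pow' _ (pow_ne_zero m hp.out.ne_zero), hmc,
      Nat.gcd_mul_right_left, Nat.mul_div_cancel_left _ (pow_pos hp.out.pos m)]
    exact hc
  obtain ⟨b, hb⟩ := IsPGroup.iff_card.mp hquot
  have hindex : A₀.index = p ^ b := by rw [Subgroup.index_eq_card, hb]
  -- `p ∤ #A₀`
  have hA₀ : ¬ p ∣ Nat.card A₀ := by
    intro hdvd
    obtain ⟨g, hg⟩ := exists_prime_orderOf_dvd_card' (G := A₀) p hdvd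
    have h1 : ¬ p ∣ orderOf (g : A) := (hmem g).mp g.2
    rw [Subgroup.orderOf_coe, hg] at h1
    exact h1 dvd_rfl
  have hcard : Nat.card A = p ^ b * Nat.card A₀ := by rw [← hindex, mul_comm, Subgroup.card_mul_index]
  rw [hindex, hcard, padicValNat.mul (pow_ne_zero _ hp.out.ne_zero) (Nat.card_pos (α := A₀)).ne', padicValNat.prime_pow,
    padicValNat.eq_zero_of_not_dvd hA₀, add_zero]

/-- **The `p`-Hilbert class field realised inside any algebraically closed field over `M`.** For a number field `M`, a prime `p` and an
algebraically closed `Ω ⊇ M` (algebraic over `M`), there is an intermediate field `P/M` of `Ω`, finite ABELIAN over `M`, UNRAMIFIED at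
every finite prime and at the infinite places, of degree `[P : M] = p^{ord_p h(M)}`: the fixed field of the prime-to-`p` part of
`Gal(H_M/M) ≅ Cl(M)` inside the Hilbert class field (Cox Thm. 8.10, Cor. 5.24), transported along an `M`-embedding `\bar M → Ω`.
[cite: Cox2013, §8.A Thm. 8.10 and §5.C Cor. 5.24] [cite: Washington1997, §13.3 (the `p`-Hilbert class field `L_n` of `K_n`)] -/
theorem exists_intermediateField_pHilbert (M : Type) [Field M] [NumberField M] (p : ℕ) [Fact p.Prime]
    (Ω' : Type*) [Field Ω'] [Algebra M Ω'] [IsAlgClosed Ω'] [Algebra.IsAlgebraic M Ω'] :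
    ∃ (P : IntermediateField M Ω') (_ : FiniteDimensional M P),
      IsAbelianGalois M P ∧ IsUnramifiedAtInfinitePlaces M P ∧
        (∀ v : HeightOneSpectrum (𝓞 M), Algebra.IsUnramifiedIn (𝓞 P) v.asIdeal) ∧
          Module.finrank M P = p ^ padicValNat p (classNumber M) := by
  classical
  set H := hilbertClassField M with hHdef
  -- the prime-to-`p` part `A₀` of `Gal(H/M)` and its fixed field `P₀`
  obtain ⟨A₀, -, hA₀⟩ := exists_subgroup_index_eq_pow_padicValNat_card (H ≃ₐ[M] H) p
  rw [IsGalois.card_aut_eq_finrank, hilbertClassField.finrank_eq_classNumber] at hA₀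
  set P₀ : IntermediateField M H := IntermediateField.fixedField A₀ with hP₀
  haveI : IsGalois M P₀ := IsGalois.of_fixedField_normal_subgroup A₀
  haveI : NumberField P₀ := NumberField.of_module_finite M P₀
  have hP₀deg : Module.finrank M P₀ = p ^ padicValNat p (classNumber M) := by
    rw [← hA₀]
    have h1 := Module.finrank_mul_finrank M P₀ H
    rw [hP₀, IntermediateField.finrank_fixedField_eq_card A₀] at h1
    have h2 : A₀.index * Nat.card A₀ = Nat.card (H ≃ₐ[M] H) := A₀.index_mul_card
    rw [IsGalois.card_aut_eq_finrank] at h2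
    rw [hP₀]
    exact Nat.eq_of_mul_eq_mul_right Nat.card_pos (h1.trans h2.symm)
  have hP₀inf : IsUnramifiedAtInfinitePlaces M P₀ := isUnramifiedAtInfinitePlaces_of_algHom (IsScalarTower.toAlgHom M P₀ H)
  have hP₀unr : ∀ v : HeightOneSpectrum (𝓞 M), Algebra.IsUnramifiedIn (𝓞 P₀) v.asIdeal :=
    forall_isUnramifiedIn_of_algHom (IsScalarTower.toAlgHom M P₀ H) (hilbertClassField.isUnramifiedIn M)
  -- transport along `\bar M → Ω'`
  let ψ : AlgebraicClosure M →ₐ[M] Ω' := IsAlgClosed.lift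
  set P : IntermediateField M Ω' := (IntermediateField.lift P₀).map ψ with hP
  let e : P₀ ≃ₐ[M] P := (IntermediateField.liftAlgEquiv P₀).trans (IntermediateField.equivMap (IntermediateField.lift P₀) ψ)
  haveI hPfd : FiniteDimensional M P := LinearEquiv.finiteDimensional e.toLinearEquiv
  haveI : NumberField P := NumberField.of_module_finite M P
  refine ⟨P, hPfd, IsAbelianGalois.of_algHom (e.symm : P →ₐ[M] P₀), isUnramifiedAtInfinitePlaces_of_algHom (e.symm : P →ₐ[M] P₀),
    forall_isUnramifiedIn_of_algHom (e.symm : P →ₐ[M] P₀) hP₀unr, ?_⟩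
  rw [← e.toLinearEquiv.finrank_eq, hP₀deg]

end Literature.NumberTheory.NumberFields

end
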